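import Mathlib
import HarnessLib
import Literature.Analysis.FluidPDE.TaoAveragedNoDilSteps
import Literature.Analysis.FluidPDE.TaoAveragedBetaFormAt
import Literature.Analysis.FluidPDE.TaoAveragedRhoSymbolAt
import Literature.Analysis.FluidPDE.TaoCascadeOfSingleScaleAt
import Summits.NavierStokesRegularity.NavierStokesRegularity.Theses.TaoLadderRungOne

/-!
# Route TaoLadderRungOne — item `CascadeNoDilOfSingleScaleAt` (stmt-NavierStokesRegularity-20433):
# Tao's §3.3–§3.4 + transitivity AT A GENERAL BASE TRIPLE, inside the no-dilation class (proved)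

**Statement (route decl, verbatim).** There is an absolute `ε₁ > 0` such that for `0 < ε₀ ≤ ε₁`,
every closed base triple `ξ` with moduli in `[1/2, 2]` and profiles normalised about `ξ`
(`ψ̂ⱼ ⊆ B(ξ j, ε₀³)`): if the single-scale piece `C₀` (`singleScaleForm`) is a dilation-free complex
average of `B_{η,ρ,0;ξ}` (`betaRhoZeroFormAt ξ ε₀`), then the complexified basic cascade operator
(3.6) (`cplxBasicCascadeForm ε₀ ψ₀ ψ₁ ψ₂`) is a dilation-free complex average of the Euler form `B`
(`eulerForm`).

HONEST FRAMING: a MODEL statement about T. Tao's averaged Navier–Stokes construction (J. Amer. Math.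
Soc. 29 (2016) = arXiv:1402.0290, §3: local cascade operators as averaged Euler operators), rung M_1 of
the cell harvest/h2-tao-ladder's ladder (Tao's Theorem 1.5 without dilation averaging, Remark 3.5);
nothing here concerns the true Navier–Stokes equations.

**Proof** (the 10-line pattern of the tree's `normalised_isComplexAverageNoDil`, which is the `xi0`
case, with every step re-run about `ξ`; threshold `ε₁ = 1/1000`):
* (2♭) §3.4 about `ξ`: `cascade_of_singleScaleAt_noDil` (`TaoCascadeOfSingleScaleAt.lean`):
  `C` is a dilation-free complex average of `B_{η,ρ;ξ}` (`betaRhoFormAt`);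
* (6♭) §3.3 last paragraph about `ξ`: `betaRhoFormAt_isComplexAverageNoDil` below — the one-point
  datum `rhoDatumAt` (`m₁ = ρ_ξ ∈ 𝓜₀ ⊗ ℂ`, `TaoAveragedRhoSymbolAt.lean`) represents `B_{η,ρ;ξ}` as a
  dilation-free complex average of `B_{η;ξ}` (`betaFormAt`);
* (3♭) §3.3 about `ξ`: `betaFormAt_isComplexAverageNoDil` (`TaoAveragedBetaFormAt.lean`, the
  `D^{it}` datum): `B_{η;ξ}` is a dilation-free complex average of `B`;
* (4♭) transitivity with `λ₁λ₂ = 1`: `IsComplexAverageNoDilOf.trans_eulerForm` (twice).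
The closure hypothesis `ξ 0 + ξ 1 + ξ 2 = 0` of the item is not needed by §3.3–§3.4.
-/

-- the sub-problem namespace `Summit.NavierStokesRegularity.NavierStokesRegularity` repeats the summit name by design (D-0017)
set_option linter.dupNamespace false

namespace Summit.NavierStokesRegularity.NavierStokesRegularity.Theorems

open MeasureTheory
open Literature.Analysis.FluidPDE.Tao2016
open Summit.NavierStokesRegularity.NavierStokesRegularity.Theses.TaoLadderRungOne

/-- **(6♭) Tao 2016, §3.3, last paragraph, about an arbitrary base triple and without dilations**:
for base moduli in `[1/2, 2]` and `0 < ε₀ ≤ 1/20`, `B_{η,ρ;ξ}` is a DILATION-FREE complex average of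
`B_{η;ξ}` — the one-point datum `rhoDatumAt` (`m₁ = ρ_ξ`, `m₂ = m₃ = 1`, `R = id`, `λ = 1`), since
`\widehat{ρ_ξ(D)u} = ρ_ξ û` turns the weight `η_ξ` into `ρ_ξ η_ξ`.
[cite: Tao2016AveragedNS, §3.3 p. 16 and Remark 3.5 p. 20] -/
theorem taoLadderRungOne_betaRhoFormAt_isComplexAverageNoDil {ξ : Fin 3 → EuclideanSpace ℝ (Fin 3)}
    (hξ : ∀ j, 1 / 2 ≤ ‖ξ j‖ ∧ ‖ξ j‖ ≤ 2) {ε₀ : ℝ} (hε : 0 < ε₀) (hε' : ε₀ ≤ 1 / 20) :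
    IsComplexAverageNoDilOf (betaRhoFormAt ξ ε₀) (betaFormAt ξ ε₀) := by
  refine ⟨rhoDatumAt hξ hε hε', fun _ _ => rfl, fun u v w _ _ _ => ?_⟩
  rw [rhoDatumAt_average, rhoDatumAt_slot_zero,
    rhoDatumAt_slot_of_ne_zero hξ hε hε' (show (1 : Fin 3) ≠ 0 by decide),
    rhoDatumAt_slot_of_ne_zero hξ hε hε' (show (2 : Fin 3) ≠ 0 by decide)]
  show betaRhoFormAt ξ ε₀ u v w = -(Real.pi * Complex.I) *
    weightedForm (fun p => etaAt ξ ε₀ ‖p.1‖ ‖p.2‖ ‖-p.1 - p.2‖) _ v w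
  rw [weightedForm_rhoAtMultiplier hξ hε hε', betaRhoFormAt_eq_weightedForm]
  rfl

/-- **Item `CascadeNoDilOfSingleScaleAt` of route TaoLadderRungOne, PROVED** (threshold
`ε₁ = 1/1000`): §3.4, §3.3 and transitivity about a general base triple with moduli in `[1/2, 2]`,
every datum having `λ ≡ 1`. [cite: Tao2016AveragedNS, §3.2 ¶3, §3.3–3.4 pp. 16–17, Remark 3.5 p. 20] -/
theorem taoLadderRungOne_cascadeNoDilOfSingleScaleAt_proof : CascadeNoDilOfSingleScaleAt := by
  refine ⟨1 / 1000, by norm_num, fun ε₀ hε₀ hle ξ _ hξ ψ hψ hC₀ => ?_⟩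
  have hle20 : ε₀ ≤ 1 / 20 := hle.trans (by norm_num)
  have hle10 : ε₀ ≤ 1 / 10 := hle.trans (by norm_num)
  have hC : IsComplexAverageNoDilOf (cplxBasicCascadeForm ε₀ (ψ 0) (ψ 1) (ψ 2)) (betaRhoFormAt ξ ε₀) :=
    cascade_of_singleScaleAt_noDil hξ hε₀ hle hψ hC₀
  have hBrho : IsComplexAverageNoDilOf (betaRhoFormAt ξ ε₀) eulerForm :=
    (taoLadderRungOne_betaRhoFormAt_isComplexAverageNoDil hξ hε₀ hle20).trans_eulerForm
      (betaFormAt_isComplexAverageNoDil hξ hε₀ hle10)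
  exact hC.trans_eulerForm hBrho

end Summit.NavierStokesRegularity.NavierStokesRegularity.Theorems
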